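import Literature.AnabelianGeometry.EtaleTheta.Discharge.Sec5Prop52InstanceForms
import Literature.AnabelianGeometry.EtaleTheta.Discharge.Sec5Prop52OfBiKummerData
import Literature.AnabelianGeometry.EtaleTheta.Discharge.Sec5Prop52iiOfConnectedTemperoid
import Literature.AnabelianGeometry.EtaleTheta.Discharge.Sec5SgpUniqueAtGenuineBases

/-!
# [EtTh] Prop. 5.2 (ii)/(iii) p.324, §5 p.331 (PDF pp.98, 105): the rows `StrvSection` (F-0555), `ThetaPairActionsAgree` (F-0556), `ThetaPairKummerClass` (F-0558) BY NAME at every genuine §5 constructor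

Mochizuki, *The étale theta function and its Frobenioid-theoretic manifestations*, Publ. RIMS **45** (2009)
[cite: MochizukiEtTh2009, Prop 5.2 p.324 (PDF p.98); §5 p.331 (PDF p.105); Prop 4.3 (iii) p.317 (PDF p.91)].  abc-iut cell,
block F (FACT-PROVING wave, batch 2), seat abc-iut-f-126 (gen 2; tranche 126 = FACT-LIST rows **F-0555** `ThetaFrobenioid.StrvSection`,
**F-0556** `FrobenioidThetaBiKummer.ThetaPairActionsAgree`, **F-0558** `FrobenioidThetaBiKummer.ThetaPairKummerClass`, trunk
`FrobenioidThetaBiKummer.lean`).  PROOF-ONLY sequel of this seat's `Discharge/Sec5Prop52InstanceForms.lean` (p432149, abstract instance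
forms) and `Discharge/Sec5Prop52OfBiKummerData.lean` (p433476, instance forms at `ofRootData` / `ofBiKummerData` / `ofConnectedTemperoidData`):
no `def`, no `Prop` fact, no instance; nothing landed is edited or restated — every conjunct that already has a name is CITED
(abc-iut-L2-t4's `strvSection_…`, `sgpCapSpec_…` / `sgpCupSpec_…`, `biKummerDifferenceMem_levelData`; abc-iut-w6-d054's
`biKummerDifferenceMem_ofConnectedTemperoid(Ydd)Data`; abc-iut-f-125's `biKummerDifferenceMem_ofTemperoidData` (p434727);
abc-iut-w6-d086's `thetaPairActionsAgree_iff_definingRelations_of_totallyEpi` (p433092); [FrdI] Thm. 5.2 total epimorphicity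
`epi_of_model`).  The twin of abc-iut-f-125's `Discharge/Sec5SgpUniqueAtGenuineBases.lean` (F-0551–F-0554 at the same constructors).

The three rows are `parametrised` predicates on the DATA-ONLY interface `𝔉 : ThetaFrobenioid C D` (universal closures REFUTED,
abc-iut-w6-d043 `Sec5BiKummerSchemaVerdicts`; FACT-LIST rule R5: consumed at NAMED instances).  WHAT IS NEW HERE:

* `prop52Rows_of` — the generic assembly: `StrvSection` and Prop. 4.3 (iii) (`BiKummerDifferenceMem`) give the tranche-126 certificate
  `StrvSection ∧ (A_N Aut-ample) ∧ (∀ ν, ∃ η, ThetaPairKummerClass η ν)` (the `η`-EXISTENTIAL form of F-0558, witness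
  `η := ν⁻¹ ∘ (s^⊓-gp_N · (s^⊔-gp_N)⁻¹)`, `u := 1`; the PINNED `η` — reduction mod `N` of `η̲̈^Θ` — is NOT claimed, cf.
  `Discharge/Sec5ThetaSectionCompatOfKummerClass.lean`).
* Over the GENUINE connected base `B^temp(Π^tp_X)⁰` (`ofConnectedTemperoidData`): the certificate MODULO THE SINGLE PRINTED INPUT `hH`
  (`Π^tp_Ÿ ⊆ H_⊙`, §5 p.322) — `prop52Rows_ofConnectedTemperoidData_of_hH` — where p433476 needed `hH`, `hconst` (Def. 3.6 (iii)) and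
  `hgc` (Lemma 5.8) because it went through the bundle `Facts`; and with `A_⊙^bs := Ÿ` (`mkOfConnectedTemperoidYdd`) with an EMPTY
  named-hypothesis list: `prop52Rows_ofConnectedTemperoidYddData`.
* Over the tempered base `B^temp(Π^tp_X)` (`ofTemperoidData`): `isAutAmple_AN_ofTemperoidData`, `thetaPairActionsAgree_ofTemperoidData_iff`
  (Prop. 5.2 (ii) as a characterisation, UNCONDITIONAL), `prop52Rows_ofTemperoidData` (mod `hH`).
* The tower-level forms (every level `N ≥ 1` of `ThetaFrobenioidTower.levelData` / `ofConnectedTemperoidFamily.atLevel`) are the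
  sibling file `Discharge/Sec5Prop52AtTowerLevels.lean` (same seat, filed alongside; independent imports).

HONEST FRAMING: kernel-checked consequences for data so constructed, under the printed [FrdI]/§1–§4 inputs listed as hypotheses;
nothing of [EtTh] (a refereed paper) is asserted unconditionally; a FACT row is an assumption label, not an endorsement; nothing here
bears on [IUTchIII] Cor. 3.12; no side is taken; typed ≠ proved.
-/

noncomputable section

namespace Literature.AnabelianGeometry.EtaleTheta

open CategoryTheory Opposite Literature.AlgebraicGeometry.Frobenioids Literature.AnabelianGeometry.SemiGraphs
  Literature.AnabelianGeometry.SemiGraphs.GaloisObjects Literature.AlgebraicGeometry.Frobenioids.QuasiTemperoid.BTempConnected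

universe u₀ v₀ u v w w' v' u' u''

namespace ThetaFrobenioid

/-! ### Generic assembly over any §5 datum -/

section Generic

variable {C : Type u'} [Category.{v'} C] {D : Type u''} [Category.{w'} D] (𝔉 : ThetaFrobenioid.{w} C D)

/-- **The tranche-126 certificate from two named §5 facts**: F-0555 `StrvSection` (kept, and its consequence "`A_N` is Aut-ample",
[FrdI] Def. 1.2 (iv), `isAutAmple_AN_of_strvSection`) and Prop. 4.3 (iii) `BiKummerDifferenceMem` (F-0551), which yields F-0558 in
`η`-existential form for EVERY comparison `ν` (`exists_thetaPairKummerClass_of_biKummerDifferenceMem`, witness `u := 1`).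
[cite: MochizukiEtTh2009, Prop 5.2 (iii) p.324 (PDF p.98); §5 p.330–331 (PDF pp.104–105)] -/
theorem prop52Rows_of (hs : 𝔉.StrvSection) (hd : 𝔉.BiKummerDifferenceMem) :
    𝔉.StrvSection ∧ 𝔉.IsAutAmple 𝔉.AN ∧
      ∀ ν : 𝔉.lDeltaModN 𝔉.BN ≃* 𝔉.muTorsion 𝔉.BN 𝔉.N,
        ∃ η : 𝔉.HB → 𝔉.lDeltaModN 𝔉.BN, FrobenioidThetaBiKummer.ThetaPairKummerClass 𝔉 η ν :=
  ⟨hs, 𝔉.isAutAmple_AN_of_strvSection hs, fun ν => exists_thetaPairKummerClass_of_biKummerDifferenceMem hd ν⟩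

/-- The same from abc-iut-L2-t4's bundle `Facts` (fields `strvSection`, `biKummerDifferenceMem`), for consumers carrying it BY NAME.
[cite: MochizukiEtTh2009, Prop 5.2 (iii) p.324 (PDF p.98); §5 p.330–331 (PDF pp.104–105)] -/
theorem prop52Rows_of_facts (H : 𝔉.Facts) :
    𝔉.StrvSection ∧ 𝔉.IsAutAmple 𝔉.AN ∧
      ∀ ν : 𝔉.lDeltaModN 𝔉.BN ≃* 𝔉.muTorsion 𝔉.BN 𝔉.N,
        ∃ η : 𝔉.HB → 𝔉.lDeltaModN 𝔉.BN, FrobenioidThetaBiKummer.ThetaPairKummerClass 𝔉 η ν :=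
  𝔉.prop52Rows_of H.strvSection H.biKummerDifferenceMem

end Generic

/-! ### Over the GENUINE connected base `B^temp(Π^tp_X)⁰` (`ofConnectedTemperoidData`): modulo `hH` alone -/

section OfConnectedTemperoidData

variable {K : Type u₀} [Field K] {X : SemiGraphs.TemperedArithmeticGroup.{u₀} K} {D₀ : Type u₀} [Category.{v₀} D₀]
  {V : FrdIMonoidStub.{w}} {T₀ : RealifiedDivisorMonoids (D₀ := D₀) V}
  {VD : FrdICatStub.{u₀ + 1, u₀, w} (ConnectedPart (BTemp X.Pi))}
  {tf : TemperedFrobenioid T₀ (ConnectedPart (BTemp X.Pi)) VD} {hZ : tf.monoidType = MonoidType.Z}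
  {hP : ∀ A : (ConnectedPart (BTemp X.Pi))ᵒᵖ, IsPerfect (tf.Φ.carrier A)}
  {NH : Subgroup (Field.absoluteGaloisGroup K) → tf.category → ℕ+ → Prop} {A₀ : tf.category}
  {hA₀ : PreFrobenioid.IsFrobeniusTrivial tf.toElem A₀} {hA₀' : SemiGraphs.IsGaloisObj A₀.base.obj}
  {pullFrac : ∀ {A A' : (BiKummerSetting.mkOfConnectedTemperoid X tf hZ hP NH A₀ hA₀ hA₀').C} (_ : A' ⟶ A),
    (BiKummerSetting.mkOfConnectedTemperoid X tf hZ hP NH A₀ hA₀ hA₀').biratUnits A →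
      (BiKummerSetting.mkOfConnectedTemperoid X tf hZ hP NH A₀ hA₀ hA₀').biratUnits A'}
  {lv N : ℕ+} {T : ThetaEnvData.{max u₀ w} N}
  {θ : (BiKummerSetting.mkOfConnectedTemperoid X tf hZ hP NH A₀ hA₀ hA₀').biratUnits
    (BiKummerSetting.mkOfConnectedTemperoid X tf hZ hP NH A₀ hA₀ hA₀').Aodot}
  {Bl : (BiKummerSetting.mkOfConnectedTemperoid X tf hZ hP NH A₀ hA₀ hA₀').C}
  {Pl : (BiKummerSetting.mkOfConnectedTemperoid X tf hZ hP NH A₀ hA₀ hA₀').FractionPair θ Bl}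
  {Rl : (BiKummerSetting.mkOfConnectedTemperoid X tf hZ hP NH A₀ hA₀ hA₀').NthRoot θ Pl lv pullFrac}
  (h : ModelFrobenioid.Hypotheses tf.divisorMonoid tf.ratFnFunctor)
  (Q : FrobenioidTheta.ThetaSubquotientStub.{w} (ConnectedPart (BTemp X.Pi))) (odd_l : Odd (lv : ℕ))
  (R : (BiKummerSetting.mkOfConnectedTemperoid X tf hZ hP NH A₀ hA₀ hA₀').NthRoot Rl.root Rl.pair N pullFrac)
  (ιX : T.PiX ≃ₜ* X.Pi) (K' : Type w) [Field K'] (constEmb : K'ˣ →* tf.biratUnitsModel R.BN)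
  (constEmb_injective : Function.Injective constEmb)
  (hinvc : ∀ g : Aut R.AN.base,
    pull tf.divisorMonoid g.hom (ModelFrobenioid.div R.pair.num) = ModelFrobenioid.div R.pair.num)
  (hinvp : ∀ y : T.PiX, y ∈ T.PiYdd →
    pull tf.divisorMonoid ((BiKummerSetting.mkOfConnectedTemperoid X tf hZ hP NH A₀ hA₀ hA₀').galoisSurj R.AN.base
      R.αData.isGalois (ιX y)).hom (ModelFrobenioid.div R.pair.den) = ModelFrobenioid.div R.pair.den)

/-- **F-0558 over `B^temp(Π^tp_X)⁰`, `η`-existential form, MODULO `hH` ALONE** (`Π^tp_Ÿ ⊆ H_⊙`, §5 p.322 (PDF p.96)): for EVERY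
comparison `ν`, SOME cocycle on `H_{B_N}` satisfies Prop. 5.2 (iii) in cocycle form — from abc-iut-w6-d054's Prop. 4.3 (iii)
`biKummerDifferenceMem_ofConnectedTemperoidData` (mod `hH`); p433476's `exists_thetaPairKummerClass_ofConnectedTemperoidData` took
`hH`, `hconst`, `hgc` (through `Facts`).  [cite: MochizukiEtTh2009, Prop 5.2 (iii) p.324 (PDF p.98); Prop 4.3 (iii) p.317 (PDF p.91)] -/
theorem exists_thetaPairKummerClass_ofConnectedTemperoidData_of_hH
    (hH : ∀ y : T.PiX, y ∈ T.PiYdd → ιX y ∈ (BiKummerSetting.mkOfConnectedTemperoid X tf hZ hP NH A₀ hA₀ hA₀').Hodot)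
    (ν : (ofConnectedTemperoidData h Q odd_l R ιX K' constEmb constEmb_injective hinvc hinvp).lDeltaModN
        (ofConnectedTemperoidData h Q odd_l R ιX K' constEmb constEmb_injective hinvc hinvp).BN ≃*
      (ofConnectedTemperoidData h Q odd_l R ιX K' constEmb constEmb_injective hinvc hinvp).muTorsion
        (ofConnectedTemperoidData h Q odd_l R ιX K' constEmb constEmb_injective hinvc hinvp).BN
        (ofConnectedTemperoidData h Q odd_l R ιX K' constEmb constEmb_injective hinvc hinvp).N) :
    ∃ η : (ofConnectedTemperoidData h Q odd_l R ιX K' constEmb constEmb_injective hinvc hinvp).HB →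
        (ofConnectedTemperoidData h Q odd_l R ιX K' constEmb constEmb_injective hinvc hinvp).lDeltaModN
          (ofConnectedTemperoidData h Q odd_l R ιX K' constEmb constEmb_injective hinvc hinvp).BN,
      FrobenioidThetaBiKummer.ThetaPairKummerClass
        (ofConnectedTemperoidData h Q odd_l R ιX K' constEmb constEmb_injective hinvc hinvp) η ν :=
  exists_thetaPairKummerClass_of_biKummerDifferenceMem
    (biKummerDifferenceMem_ofConnectedTemperoidData h Q odd_l R ιX K' constEmb constEmb_injective hinvc hinvp hH) ν

/-- **Tranche-126 certificate over `B^temp(Π^tp_X)⁰` MODULO THE SINGLE PRINTED INPUT `hH`**: F-0555 `StrvSection` (abc-iut-L2-t4's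
`strvSection_ofConnectedTemperoidData`, UNCONDITIONAL), "`A_N` is Aut-ample", and F-0558 in `η`-existential form for every `ν`; F-0556
there (⟺ the defining relations, UNCONDITIONAL) is abc-iut-w6-d086's `thetaPairActionsAgree_ofConnectedTemperoidData_iff`.
[cite: MochizukiEtTh2009, Prop 5.2 p.324 (PDF p.98); §5 p.331 (PDF p.105)] -/
theorem prop52Rows_ofConnectedTemperoidData_of_hH
    (hH : ∀ y : T.PiX, y ∈ T.PiYdd → ιX y ∈ (BiKummerSetting.mkOfConnectedTemperoid X tf hZ hP NH A₀ hA₀ hA₀').Hodot) :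
    (ofConnectedTemperoidData h Q odd_l R ιX K' constEmb constEmb_injective hinvc hinvp).StrvSection ∧
    (ofConnectedTemperoidData h Q odd_l R ιX K' constEmb constEmb_injective hinvc hinvp).IsAutAmple
        (ofConnectedTemperoidData h Q odd_l R ιX K' constEmb constEmb_injective hinvc hinvp).AN ∧
    ∀ ν : (ofConnectedTemperoidData h Q odd_l R ιX K' constEmb constEmb_injective hinvc hinvp).lDeltaModN
          (ofConnectedTemperoidData h Q odd_l R ιX K' constEmb constEmb_injective hinvc hinvp).BN ≃*
        (ofConnectedTemperoidData h Q odd_l R ιX K' constEmb constEmb_injective hinvc hinvp).muTorsion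
          (ofConnectedTemperoidData h Q odd_l R ιX K' constEmb constEmb_injective hinvc hinvp).BN
          (ofConnectedTemperoidData h Q odd_l R ιX K' constEmb constEmb_injective hinvc hinvp).N,
      ∃ η : (ofConnectedTemperoidData h Q odd_l R ιX K' constEmb constEmb_injective hinvc hinvp).HB →
          (ofConnectedTemperoidData h Q odd_l R ιX K' constEmb constEmb_injective hinvc hinvp).lDeltaModN
            (ofConnectedTemperoidData h Q odd_l R ιX K' constEmb constEmb_injective hinvc hinvp).BN,
        FrobenioidThetaBiKummer.ThetaPairKummerClass
          (ofConnectedTemperoidData h Q odd_l R ιX K' constEmb constEmb_injective hinvc hinvp) η ν :=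
  prop52Rows_of _ (strvSection_ofConnectedTemperoidData h Q odd_l R ιX K' constEmb constEmb_injective hinvc hinvp)
    (biKummerDifferenceMem_ofConnectedTemperoidData h Q odd_l R ιX K' constEmb constEmb_injective hinvc hinvp hH)

end OfConnectedTemperoidData

/-! ### Over `B^temp(Π^tp_X)⁰` with `A_⊙^bs := Ÿ` (`mkOfConnectedTemperoidYdd`): NO named input -/

section OfConnectedTemperoidYddData

variable {K : Type u₀} [Field K] {X : SemiGraphs.TemperedArithmeticGroup.{u₀} K} {D₀ : Type u₀} [Category.{v₀} D₀]
  {V : FrdIMonoidStub.{w}} {T₀ : RealifiedDivisorMonoids (D₀ := D₀) V}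
  {VD : FrdICatStub.{u₀ + 1, u₀, w} (ConnectedPart (BTemp X.Pi))}
  {tf : TemperedFrobenioid T₀ (ConnectedPart (BTemp X.Pi)) VD} {hZ : tf.monoidType = MonoidType.Z}
  {hP : ∀ A : (ConnectedPart (BTemp X.Pi))ᵒᵖ, IsPerfect (tf.Φ.carrier A)}
  {NH : Subgroup (Field.absoluteGaloisGroup K) → tf.category → ℕ+ → Prop}
  {lv N : ℕ+} {T : ThetaEnvData.{max u₀ w} N} {ιX : T.PiX ≃ₜ* X.Pi}
  {pullFrac : ∀ {A A' : (BiKummerSetting.mkOfConnectedTemperoidYdd X tf hZ hP NH T ιX).C} (_ : A' ⟶ A),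
    (BiKummerSetting.mkOfConnectedTemperoidYdd X tf hZ hP NH T ιX).biratUnits A →
      (BiKummerSetting.mkOfConnectedTemperoidYdd X tf hZ hP NH T ιX).biratUnits A'}
  {θ : (BiKummerSetting.mkOfConnectedTemperoidYdd X tf hZ hP NH T ιX).biratUnits
    (BiKummerSetting.mkOfConnectedTemperoidYdd X tf hZ hP NH T ιX).Aodot}
  {Bl : (BiKummerSetting.mkOfConnectedTemperoidYdd X tf hZ hP NH T ιX).C}
  {Pl : (BiKummerSetting.mkOfConnectedTemperoidYdd X tf hZ hP NH T ιX).FractionPair θ Bl}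
  {Rl : (BiKummerSetting.mkOfConnectedTemperoidYdd X tf hZ hP NH T ιX).NthRoot θ Pl lv pullFrac}
  (h : ModelFrobenioid.Hypotheses tf.divisorMonoid tf.ratFnFunctor)
  (Q : FrobenioidTheta.ThetaSubquotientStub.{w} (ConnectedPart (BTemp X.Pi))) (odd_l : Odd (lv : ℕ))
  (R : (BiKummerSetting.mkOfConnectedTemperoidYdd X tf hZ hP NH T ιX).NthRoot Rl.root Rl.pair N pullFrac)
  (K' : Type w) [Field K'] (constEmb : K'ˣ →* tf.biratUnitsModel R.BN) (constEmb_injective : Function.Injective constEmb)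
  (hinvc : ∀ g : Aut R.AN.base,
    pull tf.divisorMonoid g.hom (ModelFrobenioid.div R.pair.num) = ModelFrobenioid.div R.pair.num)
  (hinvp : ∀ y : T.PiX, y ∈ T.PiYdd →
    pull tf.divisorMonoid ((BiKummerSetting.mkOfConnectedTemperoidYdd X tf hZ hP NH T ιX).galoisSurj R.AN.base
      R.αData.isGalois (ιX y)).hom (ModelFrobenioid.div R.pair.den) = ModelFrobenioid.div R.pair.den)

/-- **F-0558 with NO named input**, `η`-existential form, for the §5 data over `B^temp(Π^tp_X)⁰` with `A_⊙^bs := Ÿ` (`hH` is abc-iut-L2-t4's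
theorem `hH_mkOfConnectedTemperoidYdd`; Prop. 4.3 (iii) there = abc-iut-w6-d054's `biKummerDifferenceMem_ofConnectedTemperoidYddData`).
[cite: MochizukiEtTh2009, Prop 5.2 (iii) p.324 (PDF p.98); Prop 4.3 (iii) p.317 (PDF p.91)] -/
theorem exists_thetaPairKummerClass_ofConnectedTemperoidYddData
    (ν : (ofConnectedTemperoidData h Q odd_l R ιX K' constEmb constEmb_injective hinvc hinvp).lDeltaModN
        (ofConnectedTemperoidData h Q odd_l R ιX K' constEmb constEmb_injective hinvc hinvp).BN ≃*
      (ofConnectedTemperoidData h Q odd_l R ιX K' constEmb constEmb_injective hinvc hinvp).muTorsion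
        (ofConnectedTemperoidData h Q odd_l R ιX K' constEmb constEmb_injective hinvc hinvp).BN
        (ofConnectedTemperoidData h Q odd_l R ιX K' constEmb constEmb_injective hinvc hinvp).N) :
    ∃ η : (ofConnectedTemperoidData h Q odd_l R ιX K' constEmb constEmb_injective hinvc hinvp).HB →
        (ofConnectedTemperoidData h Q odd_l R ιX K' constEmb constEmb_injective hinvc hinvp).lDeltaModN
          (ofConnectedTemperoidData h Q odd_l R ιX K' constEmb constEmb_injective hinvc hinvp).BN,
      FrobenioidThetaBiKummer.ThetaPairKummerClass
        (ofConnectedTemperoidData h Q odd_l R ιX K' constEmb constEmb_injective hinvc hinvp) η ν :=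
  exists_thetaPairKummerClass_of_biKummerDifferenceMem
    (biKummerDifferenceMem_ofConnectedTemperoidYddData h Q odd_l R K' constEmb constEmb_injective hinvc hinvp) ν

/-- **Tranche-126 certificate with an EMPTY named-hypothesis list beyond the construction data**: for the §5 data over the genuine
connected base `B^temp(Π^tp_X)⁰` with `A_⊙^bs := Ÿ`, F-0555 `StrvSection`, "`A_N` is Aut-ample" and F-0558 (`η`-existential, every `ν`)
are THEOREMS of the data.  Inputs: `h` ([FrdI] Thm. 5.2 hypotheses of the model), `Q`, the roots `Rl`/`R`, the constants `constEmb`, the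
divisor invariances `hinvc` (p.330) / `hinvp` (Prop. 4.3 (i) proof, p.317) — no section hypothesis, no dictionary law, no `Facts` bundle, no
FACT-LIST name.  [cite: MochizukiEtTh2009, Prop 5.2 p.324 (PDF p.98); §5 p.331 (PDF p.105)] -/
theorem prop52Rows_ofConnectedTemperoidYddData :
    (ofConnectedTemperoidData h Q odd_l R ιX K' constEmb constEmb_injective hinvc hinvp).StrvSection ∧
    (ofConnectedTemperoidData h Q odd_l R ιX K' constEmb constEmb_injective hinvc hinvp).IsAutAmple
        (ofConnectedTemperoidData h Q odd_l R ιX K' constEmb constEmb_injective hinvc hinvp).AN ∧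
    ∀ ν : (ofConnectedTemperoidData h Q odd_l R ιX K' constEmb constEmb_injective hinvc hinvp).lDeltaModN
          (ofConnectedTemperoidData h Q odd_l R ιX K' constEmb constEmb_injective hinvc hinvp).BN ≃*
        (ofConnectedTemperoidData h Q odd_l R ιX K' constEmb constEmb_injective hinvc hinvp).muTorsion
          (ofConnectedTemperoidData h Q odd_l R ιX K' constEmb constEmb_injective hinvc hinvp).BN
          (ofConnectedTemperoidData h Q odd_l R ιX K' constEmb constEmb_injective hinvc hinvp).N,
      ∃ η : (ofConnectedTemperoidData h Q odd_l R ιX K' constEmb constEmb_injective hinvc hinvp).HB →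
          (ofConnectedTemperoidData h Q odd_l R ιX K' constEmb constEmb_injective hinvc hinvp).lDeltaModN
            (ofConnectedTemperoidData h Q odd_l R ιX K' constEmb constEmb_injective hinvc hinvp).BN,
        FrobenioidThetaBiKummer.ThetaPairKummerClass
          (ofConnectedTemperoidData h Q odd_l R ιX K' constEmb constEmb_injective hinvc hinvp) η ν :=
  prop52Rows_ofConnectedTemperoidData_of_hH h Q odd_l R ιX K' constEmb constEmb_injective hinvc hinvp
    (BiKummerSetting.hH_mkOfConnectedTemperoidYdd X tf hZ hP NH T ιX)

end OfConnectedTemperoidYddData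

/-! ### Over the tempered base `B^temp(Π^tp_X)` (`ofTemperoidData`) -/

section OfTemperoidData

variable {K : Type u₀} [Field K] {X : SemiGraphs.TemperedArithmeticGroup.{u₀} K} {D₀ : Type u₀} [Category.{v₀} D₀]
  {V : FrdIMonoidStub.{w}} {T₀ : RealifiedDivisorMonoids (D₀ := D₀) V} {VD : FrdICatStub.{u₀ + 1, u₀, w} (BTemp X.Pi)}
  {tf : TemperedFrobenioid T₀ (BTemp X.Pi) VD} {hZ : tf.monoidType = MonoidType.Z}
  {hP : ∀ A : (BTemp X.Pi)ᵒᵖ, IsPerfect (tf.Φ.carrier A)}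
  {NH : Subgroup (Field.absoluteGaloisGroup K) → tf.category → ℕ+ → Prop} {A₀ : tf.category}
  {hA₀ : PreFrobenioid.IsFrobeniusTrivial tf.toElem A₀} {hA₀' : SemiGraphs.IsGaloisObj A₀.base}
  {pullFrac : ∀ {A A' : (BiKummerSetting.mkOfTemperoid X tf hZ hP NH A₀ hA₀ hA₀').C} (_ : A' ⟶ A),
    (BiKummerSetting.mkOfTemperoid X tf hZ hP NH A₀ hA₀ hA₀').biratUnits A →
      (BiKummerSetting.mkOfTemperoid X tf hZ hP NH A₀ hA₀ hA₀').biratUnits A'}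
  {lv N : ℕ+} {T : ThetaEnvData.{max u₀ w} N}
  {θ : (BiKummerSetting.mkOfTemperoid X tf hZ hP NH A₀ hA₀ hA₀').biratUnits
    (BiKummerSetting.mkOfTemperoid X tf hZ hP NH A₀ hA₀ hA₀').Aodot}
  {Bl : (BiKummerSetting.mkOfTemperoid X tf hZ hP NH A₀ hA₀ hA₀').C}
  {Pl : (BiKummerSetting.mkOfTemperoid X tf hZ hP NH A₀ hA₀ hA₀').FractionPair θ Bl}
  {Rl : (BiKummerSetting.mkOfTemperoid X tf hZ hP NH A₀ hA₀ hA₀').NthRoot θ Pl lv pullFrac}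
  (h : ModelFrobenioid.Hypotheses tf.divisorMonoid tf.ratFnFunctor)
  (Q : FrobenioidTheta.ThetaSubquotientStub.{w} (BTemp X.Pi)) (odd_l : Odd (lv : ℕ))
  (R : (BiKummerSetting.mkOfTemperoid X tf hZ hP NH A₀ hA₀ hA₀').NthRoot Rl.root Rl.pair N pullFrac)
  (ιX : T.PiX ≃ₜ* X.Pi) (K' : Type w) [Field K'] (constEmb : K'ˣ →* tf.biratUnitsModel R.BN)
  (constEmb_injective : Function.Injective constEmb)
  (hinvc : ∀ g : Aut R.AN.base,
    pull tf.divisorMonoid g.hom (ModelFrobenioid.div R.pair.num) = ModelFrobenioid.div R.pair.num)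
  (hinvp : ∀ y : T.PiX, y ∈ T.PiYdd →
    pull tf.divisorMonoid (galoisSurjOf X.isTempered R.AN.base R.αData.isGalois (ιX y)).hom
      (ModelFrobenioid.div R.pair.den) = ModelFrobenioid.div R.pair.den)

/-- **F-0555 consequence over `B^temp(Π^tp_X)`, UNCONDITIONAL**: "`A_N` is Aut-ample" ([FrdI] Def. 1.2 (iv)) for the §5 data over the
tempered base (`s^trv_N` constructed; abc-iut-L2-t9 / abc-iut-w5-d019's `strvSection_ofTemperoidData`).
[cite: MochizukiEtTh2009, §5 p.330–331 (PDF pp.104–105)] -/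
theorem isAutAmple_AN_ofTemperoidData :
    (ofTemperoidData h Q odd_l R ιX K' constEmb constEmb_injective hinvc hinvp).IsAutAmple
      (ofTemperoidData h Q odd_l R ιX K' constEmb constEmb_injective hinvc hinvp).AN :=
  isAutAmple_AN_of_strvSection _ (strvSection_ofTemperoidData h Q odd_l R ιX K' constEmb constEmb_injective hinvc hinvp)

/-- **[EtTh] Prop. 5.2 (ii) (F-0556) for the §5 data over the GENUINE tempered base `B^temp(Π^tp_X)`, as a characterisation,
UNCONDITIONAL**: a pair `(actS, actT)` of `H_{B_N}`-actions on `B_N` agrees with "the actions determined by the bi-Kummer `l·N`-th root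
[cf. Proposition 4.3, (i)]" IFF it is compatible with `s^⊓_N`, `s^⊔_N` (total epimorphicity = [FrdI] Thm. 5.2 for the model Frobenioid,
`epi_of_model`; defining relations = `sgpCapSpec_ofTemperoidData` / `sgpCupSpec_ofTemperoidData`).
[cite: MochizukiEtTh2009, Prop 5.2 (ii) p.324 (PDF p.98); §5 p.331 (PDF p.105)] -/
theorem thetaPairActionsAgree_ofTemperoidData_iff
    (actS actT : (ofTemperoidData h Q odd_l R ιX K' constEmb constEmb_injective hinvc hinvp).HB →*
      Aut (ofTemperoidData h Q odd_l R ιX K' constEmb constEmb_injective hinvc hinvp).BN) :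
    FrobenioidThetaBiKummer.ThetaPairActionsAgree (ofTemperoidData h Q odd_l R ιX K' constEmb constEmb_injective hinvc hinvp)
        actS actT ↔
      (∀ hh : (ofTemperoidData h Q odd_l R ιX K' constEmb constEmb_injective hinvc hinvp).HB,
          (ofTemperoidData h Q odd_l R ιX K' constEmb constEmb_injective hinvc hinvp).sCap ≫ (actS hh).hom =
            ((ofTemperoidData h Q odd_l R ιX K' constEmb constEmb_injective hinvc hinvp).strv
              ((ofTemperoidData h Q odd_l R ιX K' constEmb constEmb_injective hinvc hinvp).autBaseIsoAB.symm
                (hh : Aut ((ofTemperoidData h Q odd_l R ιX K' constEmb constEmb_injective hinvc hinvp).base.obj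
                  (ofTemperoidData h Q odd_l R ιX K' constEmb constEmb_injective hinvc hinvp).BN)))).hom ≫
              (ofTemperoidData h Q odd_l R ιX K' constEmb constEmb_injective hinvc hinvp).sCap) ∧
        ∀ hh : (ofTemperoidData h Q odd_l R ιX K' constEmb constEmb_injective hinvc hinvp).HB,
          (ofTemperoidData h Q odd_l R ιX K' constEmb constEmb_injective hinvc hinvp).sCup ≫ (actT hh).hom =
            ((ofTemperoidData h Q odd_l R ιX K' constEmb constEmb_injective hinvc hinvp).strv
              ((ofTemperoidData h Q odd_l R ιX K' constEmb constEmb_injective hinvc hinvp).autBaseIsoAB.symm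
                (hh : Aut ((ofTemperoidData h Q odd_l R ιX K' constEmb constEmb_injective hinvc hinvp).base.obj
                  (ofTemperoidData h Q odd_l R ιX K' constEmb constEmb_injective hinvc hinvp).BN)))).hom ≫
              (ofTemperoidData h Q odd_l R ιX K' constEmb constEmb_injective hinvc hinvp).sCup :=
  thetaPairActionsAgree_iff_definingRelations_of_totallyEpi _ (epi_of_model (DivB := tf.divBNatTrans) h)
    (sgpCapSpec_ofTemperoidData h Q odd_l R ιX K' constEmb constEmb_injective hinvc hinvp)
    (sgpCupSpec_ofTemperoidData h Q odd_l R ιX K' constEmb constEmb_injective hinvc hinvp) actS actT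

/-- **Tranche-126 certificate over `B^temp(Π^tp_X)` MODULO `hH`** (`Π^tp_Ÿ ⊆ H_⊙ = N_{A_⊙}`): F-0555 `StrvSection` (UNCONDITIONAL,
`strvSection_ofTemperoidData`), "`A_N` is Aut-ample", and F-0558 in `η`-existential form for every `ν` (Prop. 4.3 (iii) there =
abc-iut-f-125's `biKummerDifferenceMem_ofTemperoidData`, mod `hH`).  [cite: MochizukiEtTh2009, Prop 5.2 p.324 (PDF p.98); §5 p.331 (PDF p.105)] -/
theorem prop52Rows_ofTemperoidData
    (hH : ∀ y : T.PiX, y ∈ T.PiYdd → ιX y ∈ (BiKummerSetting.mkOfTemperoid X tf hZ hP NH A₀ hA₀ hA₀').Hodot) :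
    (ofTemperoidData h Q odd_l R ιX K' constEmb constEmb_injective hinvc hinvp).StrvSection ∧
    (ofTemperoidData h Q odd_l R ιX K' constEmb constEmb_injective hinvc hinvp).IsAutAmple
        (ofTemperoidData h Q odd_l R ιX K' constEmb constEmb_injective hinvc hinvp).AN ∧
    ∀ ν : (ofTemperoidData h Q odd_l R ιX K' constEmb constEmb_injective hinvc hinvp).lDeltaModN
          (ofTemperoidData h Q odd_l R ιX K' constEmb constEmb_injective hinvc hinvp).BN ≃*
        (ofTemperoidData h Q odd_l R ιX K' constEmb constEmb_injective hinvc hinvp).muTorsion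
          (ofTemperoidData h Q odd_l R ιX K' constEmb constEmb_injective hinvc hinvp).BN
          (ofTemperoidData h Q odd_l R ιX K' constEmb constEmb_injective hinvc hinvp).N,
      ∃ η : (ofTemperoidData h Q odd_l R ιX K' constEmb constEmb_injective hinvc hinvp).HB →
          (ofTemperoidData h Q odd_l R ιX K' constEmb constEmb_injective hinvc hinvp).lDeltaModN
            (ofTemperoidData h Q odd_l R ιX K' constEmb constEmb_injective hinvc hinvp).BN,
        FrobenioidThetaBiKummer.ThetaPairKummerClass
          (ofTemperoidData h Q odd_l R ιX K' constEmb constEmb_injective hinvc hinvp) η ν :=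
  prop52Rows_of _ (strvSection_ofTemperoidData h Q odd_l R ιX K' constEmb constEmb_injective hinvc hinvp)
    (biKummerDifferenceMem_ofTemperoidData h Q odd_l R ιX K' constEmb constEmb_injective hinvc hinvp hH)

end OfTemperoidData

end ThetaFrobenioid

end Literature.AnabelianGeometry.EtaleTheta

end
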